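import Literature.Probability.RandomPlanarGeometry.SAWCountZdTopCoefficients
import Literature.Probability.RandomPlanarGeometry.SAWFiniteMemoryFour
import Literature.Probability.RandomPlanarGeometry.SAWCountSmallZd
import HarnessLib

/-!
# `c_n(ℤ^d)` as a polynomial in the dimension: the THIRD coefficient `2^{n−3}(n² − 5n + 8)` via memory four

Topic `Literature/Probability/RandomPlanarGeometry` (continues `SAWCountZdTopCoefficients.lean`: zero-extension transport
`extend_mem_memWalks_iff`, the loop lemma `two_mul_card_image_le_of_loop`, and the top two coefficients `2^n, −(n−1)2^{n−1}` of `c_n(ℤ^d)`;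
uses `SAWFiniteMemoryFour.lean`: the Fisher–Sykes recurrence `MemFour.MadrasSlade1993_memCount_four_rec'`
(`c_{n+3,4} = 2(d−1)(c_{n+2,4} + c_{n+1,4}) + c_{n,4}`) and the parity lemma `MemFour.walk_ne_of_odd`; `SAWCountSmallZd.lean`:
`c₃, c₄, c₅(ℤ^d)` in closed form; `SAWFiniteMemoryLimit.lean`: `memWalks d τ n`, `memCount d τ n = c_{n,τ}`).

PRINTED CONTEXT (locators only; nothing below is quoted digit-for-digit). Madras–Slade (1993): §1.1 p. 3 (`c₁…c₄` in `d`) and eq. (1.1.8) p. 5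
(the `1/d` expansion of `μ`, after Fisher–Sykes 1959 / Fisher–Gaunt 1964); §1.2 p. 10 (walks with memory `τ`, `c_{N,τ}`) and eq. (1.2.14)
p. 11 (the Fisher–Sykes cubic for memory 4). NOT IN PRINT in this form (lane statements): the structure theorems below for `c_{n,τ} − c_n` in
every dimension and the closed form of the third coefficient of `c_n(ℤ^d)` for every `n`.

THIS FILE (lane «pcv-sawmu», a-p1 g18; all PROVED, standard axioms, NO definitions):
* ★★ `two_mul_dim_add_le_of_repeat_memory` — A REPEAT IN A MEMORY-`τ` WALK COSTS `⌈(τ+1)/2⌉` AXES: an `n`-step memory-`τ` walk of `ℤ^D`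
  with a repeated site using every axis has `2D + τ + 1 ≤ 2n` (the first loop has length `≥ τ + 1` and steps on each of its axes twice);
  `card_allAxes_badClass_memory_eq_zero`;
* ★ `card_badClass_memory_eq`, ★★ `card_bad_memory_eq_sum_choose_mul`, ★★ `memCount_eq_count_add_sum_choose` — the axis-class device of
  `SAWCountZdTopCoefficients` for general memory: `c_{n,τ}(ℤ^d) = c_n(ℤ^d) + Σ_{u < n + 1 − ⌊(τ+2)/2⌋} C(d,u) G_{n,τ}(u)` for every `d` —
  memory-`τ` counts agree with `c_n` to `⌈(τ+1)/2⌉` orders in `d`;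
* `memCount_four_five` (`c_{5,4} = c₅`), ★★ `exists_polynomial_memCount_four_topThree` — by induction on the Fisher–Sykes recurrence,
  `c_{n,4}(ℤ^d)` is a polynomial of degree `≤ n` in `d` with top three coefficients `2^n, −(n−1)2^{n−1}, 2^{n−3}(n² − 5n + 8)` (`n ≥ 3`);
* ★★★ `exists_polynomial_count_topThree` — THE TOP THREE COEFFICIENTS OF `c_n(ℤ^d)`: for every `n ≥ 3` there is `P ∈ ℚ[X]` of degree
  `≤ n` with `[X^n]P = 2^n`, `[X^{n−1}]P = −(n−1)2^{n−1}`, `[X^{n−2}]P = 2^{n−3}(n² − 5n + 8)` and `c_n(ℤ^d) = P(d)` for every `d`.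
[cite: MadrasSlade1993, §1.1 p. 3 and eq. (1.1.8) p. 5; §1.2 p. 10 and eq. (1.2.14) p. 11]

Provenance: lane «pcv-sawmu», a-p1 g18 (2026-08-26). Numerical cross-check (not used): `[d⁴] c₆ = 2³·14 = 112` (tree `count_six_eq`),
`[d⁵] c₇ = 2⁴·22 = 352`, `[d⁶] c₈ = 2⁵·32 = 1024` (lane enumerations of `N_{8,9} = c₈(ℤ^d)`: `256d⁸ − 896d⁷ + 1024d⁶ − …`).
Use (sequel, designed): this is the `n = c + 1` part of the THIRD SYMBOL of the irreducible-bridge cost census; with the one-down-step class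
`F_{c,c+2}(c−2) = C(c−1,3)(c−2)!2^{c−2}` and a third-order symbol calculus it gives the lane's observed
`[d^{k−2}] c_k^{(d)} = (−1)^{k−1}2^{k−2}(k² − 5k + 7)`.
-/

noncomputable section

open Finset
open scoped BigOperators
open Literature.Probability.LatticeModels
open Literature.Probability.RandomPlanarGeometry.SAW

namespace Literature.Probability.RandomPlanarGeometry.SAW.Zd

/-! ### A repeat in a memory-`τ` walk costs `⌈(τ+1)/2⌉` axes -/

section RepeatMemory

variable {D τ n : ℕ}

/-- The steps of a walk are unit coordinate vectors `± e_j`. [cite: MadrasSlade1993, §1.1 (p. 1); lane plumbing] -/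
private theorem th_exists_step_single {ω : ℕ → Site D} (hω : ω ∈ walks D n) {k : ℕ} (hk : k < n) :
    ∃ j : Fin D, ∃ s : ℤ, (s = 1 ∨ s = -1) ∧ ω (k + 1) - ω k = Pi.single j s := by
  obtain ⟨j, hj | hj⟩ := (zdGraph_adj_iff_sub _ _).1 ((mem_walks.1 hω).2.2 k hk)
  · exact ⟨j, 1, Or.inl rfl, hj⟩
  · refine ⟨j, -1, Or.inr rfl, ?_⟩
    rw [Pi.single_neg, ← hj, neg_sub]

/-- Each step of a walk changes exactly one coordinate, by `±1`. [cite: MadrasSlade1993, §1.1 (p. 1); lane plumbing] -/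
private theorem th_exists_axis {ω : ℕ → Site D} (hω : ω ∈ walks D n) {k : ℕ} (hk : k < n) :
    ∃ a : Fin D, (ω (k + 1) a - ω k a = 1 ∨ ω (k + 1) a - ω k a = -1) ∧ ∀ b, b ≠ a → ω (k + 1) b = ω k b := by
  obtain ⟨j, s, hs, hjs⟩ := th_exists_step_single hω hk
  refine ⟨j, ?_, fun b hb => ?_⟩
  · have h := congrFun hjs j
    rw [Pi.sub_apply, Pi.single_eq_same] at h
    rcases hs with rfl | rfl
    · exact Or.inl h
    · exact Or.inr h
  · have h := congrFun hjs b
    rw [Pi.sub_apply, Pi.single_eq_of_ne hb] at h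
    exact sub_eq_zero.1 h

/-- A coordinate that is nonzero at some time was changed by an earlier step. [cite: MadrasSlade1993, §1.1 (p. 1); lane plumbing] -/
private theorem th_exists_step_ne {ω : ℕ → Site D} (h0 : ω 0 = 0) {a : Fin D} {i : ℕ} (hi : ω i a ≠ 0) :
    ∃ k < i, ω (k + 1) a ≠ ω k a := by
  induction i with
  | zero => exact absurd (by rw [h0]; rfl) hi
  | succ i ih =>
    by_cases h : ω (i + 1) a = ω i a
    · obtain ⟨k, hk, hne⟩ := ih (by rwa [h] at hi)
      exact ⟨k, by omega, hne⟩
    · exact ⟨i, by omega, h⟩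

/-- ★★ A REPEAT IN A MEMORY-`τ` WALK COSTS `⌈(τ+1)/2⌉` AXES: an `n`-step walk of `ℤ^D` with memory `τ` and a repeated site that uses every
axis has `2D + τ + 1 ≤ 2n`. The first loop has length `ℓ ≥ τ + 1` (memory `τ`); on it every stepped axis is stepped twice
(`two_mul_card_image_le_of_loop`), so at most `ℓ/2 + (n − ℓ)` axes are stepped on, and every used axis is stepped on. (`τ = 2`:
`SAWCountZdTopCoefficients.dim_add_two_le_of_repeat`; `τ = 4`: `D + 3 ≤ n`.) [cite: MadrasSlade1993, §1.2 (p. 10: walks with memory τ); lane lemma] -/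
theorem two_mul_dim_add_le_of_repeat_memory {ω : ℕ → Site D} (hω : ω ∈ memWalks D τ n)
    (hrep : ∃ i ≤ n, ∃ j ≤ n, i < j ∧ ω i = ω j) (hall : ∀ a : Fin D, ∃ i ≤ n, ω i a ≠ (0 : ℤ)) : 2 * D + τ + 1 ≤ 2 * n := by
  classical
  obtain ⟨hw, hmem⟩ := mem_memWalks.1 hω
  have h0 : ω 0 = 0 := (mem_walks.1 hw).1
  obtain ⟨i, hi, j, hj, hij, hloop⟩ := hrep
  -- memory τ: the repeat is at distance ≥ τ + 1
  have hgap : i + τ + 1 ≤ j := by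
    by_contra hlt
    exact hmem i j hj hij (by omega) hloop
  have hn : 0 < n := by omega
  -- the axis of each step
  obtain ⟨a₀, -, -⟩ := th_exists_axis hw hn
  have hch : ∀ k, k < n → ∃ a : Fin D, (ω (k + 1) a - ω k a = 1 ∨ ω (k + 1) a - ω k a = -1) ∧
      ∀ b, b ≠ a → ω (k + 1) b = ω k b := fun k hk => th_exists_axis hw hk
  set ax : ℕ → Fin D := fun k => if hk : k < n then Classical.choose (hch k hk) else a₀ with hax
  have hax_spec : ∀ k, k < n → ∀ b, b ≠ ax k → ω (k + 1) b = ω k b := by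
    intro k hk b hb
    have hb' : b ≠ Classical.choose (hch k hk) := by
      intro h; apply hb; rw [hax]; simp only [dif_pos hk]; exact h
    exact (Classical.choose_spec (hch k hk)).2 b hb'
  -- (1) every axis is stepped on: `univ ⊆ ax '' [0, n)`
  have hcover : (Finset.univ : Finset (Fin D)) ⊆ (Finset.range n).image ax := by
    intro a _
    obtain ⟨t, ht, hne⟩ := hall a
    obtain ⟨k, hk, hstep⟩ := th_exists_step_ne h0 hne
    have hkn : k < n := by omega
    refine Finset.mem_image.2 ⟨k, Finset.mem_range.2 hkn, ?_⟩
    by_contra hka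
    exact hstep (hax_spec k hkn a (fun h => hka h.symm))
  have hD : D ≤ ((Finset.range n).image ax).card := by
    have := Finset.card_le_card hcover
    rwa [Finset.card_univ, Fintype.card_fin] at this
  -- (2) split `[0, n)` into the loop `[i, j)` and the rest
  have hIco : Finset.Ico i j ⊆ Finset.range n := fun k hk => by
    rw [Finset.mem_Ico] at hk; rw [Finset.mem_range]; omega
  have hsplit : ((Finset.range n).image ax).card ≤ ((Finset.Ico i j).image ax).card + (n - (j - i)) := by
    have hunion : (Finset.range n).image ax ⊆ (Finset.Ico i j).image ax ∪ (Finset.range n \ Finset.Ico i j).image ax := by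
      intro a ha
      obtain ⟨k, hk, rfl⟩ := Finset.mem_image.1 ha
      by_cases hkI : k ∈ Finset.Ico i j
      · exact Finset.mem_union_left _ (Finset.mem_image_of_mem _ hkI)
      · exact Finset.mem_union_right _ (Finset.mem_image_of_mem _ (Finset.mem_sdiff.2 ⟨hk, hkI⟩))
    calc ((Finset.range n).image ax).card
        ≤ ((Finset.Ico i j).image ax ∪ (Finset.range n \ Finset.Ico i j).image ax).card := Finset.card_le_card hunion
      _ ≤ ((Finset.Ico i j).image ax).card + ((Finset.range n \ Finset.Ico i j).image ax).card := Finset.card_union_le _ _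
      _ ≤ ((Finset.Ico i j).image ax).card + (Finset.range n \ Finset.Ico i j).card :=
          Nat.add_le_add_left Finset.card_image_le _
      _ = ((Finset.Ico i j).image ax).card + (n - (j - i)) := by
          rw [Finset.card_sdiff_of_subset hIco, Finset.card_range, Nat.card_Ico]
  -- (3) the loop lemma
  have hloop2 : 2 * ((Finset.Ico i j).image ax).card ≤ j - i :=
    two_mul_card_image_le_of_loop hw hij.le hj hloop ax fun k _ hk b hb => hax_spec k (by omega) b hb
  omega

/-- ★★ Hence the «all axes used» class of non-self-avoiding memory-`τ` walks of `ℤ^u` of length `n` is EMPTY unless `2u + τ + 1 ≤ 2n`.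
[cite: MadrasSlade1993, §1.2 (p. 10); lane lemma] -/
theorem card_allAxes_badClass_memory_eq_zero {u τ n : ℕ} (h : 2 * n < 2 * u + τ + 1) :
    ((memWalks u τ n).filter fun (ω : ℕ → Site u) => (∃ i ≤ n, ∃ j ≤ n, i < j ∧ ω i = ω j) ∧
        ∀ a : Fin u, ∃ i ≤ n, ω i a ≠ (0 : ℤ)).card = 0 := by
  rw [Finset.card_eq_zero, Finset.filter_eq_empty_iff]
  rintro ω hω ⟨hrep, hall⟩
  have := two_mul_dim_add_le_of_repeat_memory hω hrep hall
  omega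

end RepeatMemory

/-! ### Axis classes of the non-self-avoiding memory-`τ` walks (the device of `SAWCountZdTopCoefficients` for general `τ`) -/

section ClassesMemory

variable {d u τ n : ℕ} {e : Fin (u + 1) → Fin (d + 1)}

/-- The zero-extension agrees with `x` on the image coordinates. [cite: MadrasSlade1993, §1.1 (1.1.8); lane plumbing] -/
private theorem th_extend_apply_image (he : Function.Injective e) (x : Site (u + 1)) (a : Fin (u + 1)) :
    Function.extend e x 0 (e a) = x a :=
  he.extend_apply _ _ _

/-- The zero-extension vanishes off the image coordinates. [cite: MadrasSlade1993, §1.1 (1.1.8); lane plumbing] -/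
private theorem th_extend_apply_of_not_exists (x : Site (u + 1)) {j : Fin (d + 1)} (hj : ¬ ∃ a, e a = j) :
    Function.extend e x (0 : Fin (d + 1) → ℤ) j = 0 := by
  rw [Function.extend_apply' _ _ _ hj]; rfl

/-- `x ↦ Function.extend e x 0` is injective. [cite: MadrasSlade1993, §1.1 (1.1.8); lane plumbing] -/
private theorem th_extend_eq_extend_iff (he : Function.Injective e) {x y : Site (u + 1)} :
    Function.extend e x (0 : Fin (d + 1) → ℤ) = Function.extend e y 0 ↔ x = y := by
  constructor
  · intro h
    funext a
    have := congrFun h (e a)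
    simpa only [th_extend_apply_image he] using this
  · rintro rfl; rfl

/-- A walk is frozen after time `n`, so a coordinate vanishing up to time `n` vanishes at all times.
[cite: MadrasSlade1993, §1.2 (p. 10); lane plumbing] -/
private theorem th_apply_eq_zero_of_forall_le {E : ℕ} {ω : ℕ → Site E} (hω : ω ∈ walks E n) {j : Fin E}
    (h : ∀ i ≤ n, ω i j = 0) (i : ℕ) : ω i j = 0 := by
  by_cases hi : i ≤ n
  · exact h i hi
  · rw [(mem_walks.1 hω).2.1 i (by omega)]
    exact h n le_rfl

/-- ★ The `n`-step memory-`τ` walks of `ℤ^{d+1}` with a repeated site whose set of used axes is exactly `S` (`|S| = u + 1`) are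
equinumerous with those of `ℤ^{u+1}` that use every axis (zero-extension along the increasing bijection `Fin (u+1) ≃ S`; the case
`τ = 2` is `card_badClass_eq`). [cite: MadrasSlade1993, §1.1 eq. (1.1.8) and Notes §1.6 (the 1/d-expansion device); lane theorem] -/
theorem card_badClass_memory_eq (τ : ℕ) (S : Finset (Fin (d + 1))) (hS : S.card = u + 1) :
    ((memWalks (d + 1) τ n).filter fun (Ω : ℕ → Site (d + 1)) => (∃ i ≤ n, ∃ j ≤ n, i < j ∧ Ω i = Ω j) ∧
        (Finset.univ.filter fun (j : Fin (d + 1)) => ∃ i ≤ n, Ω i j ≠ (0 : ℤ)) = S).card =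
    ((memWalks (u + 1) τ n).filter fun (ω : ℕ → Site (u + 1)) => (∃ i ≤ n, ∃ j ≤ n, i < j ∧ ω i = ω j) ∧
        ∀ a : Fin (u + 1), ∃ i ≤ n, ω i a ≠ (0 : ℤ)).card := by
  classical
  set e : Fin (u + 1) → Fin (d + 1) := fun a => S.orderEmbOfFin hS a with hedef
  have he : Function.Injective e := fun a b h => (S.orderEmbOfFin hS).injective h
  have hmemS : ∀ a, e a ∈ S := fun a => Finset.orderEmbOfFin_mem S hS a
  have hrange : ∀ j, j ∈ S → ∃ a, e a = j := by
    intro j hj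
    have : j ∈ Set.range (S.orderEmbOfFin hS) := by rw [Finset.range_orderEmbOfFin]; exact hj
    obtain ⟨a, ha⟩ := this
    exact ⟨a, ha⟩
  have hrep : ∀ ω : ℕ → Site (u + 1),
      (∃ i ≤ n, ∃ j ≤ n, i < j ∧ Function.extend e (ω i) (0 : Fin (d + 1) → ℤ) = Function.extend e (ω j) 0) ↔
        (∃ i ≤ n, ∃ j ≤ n, i < j ∧ ω i = ω j) := by
    intro ω
    simp only [th_extend_eq_extend_iff he]
  have hext : ∀ Ω : ℕ → Site (d + 1), Ω ∈ walks (d + 1) n →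
      (Finset.univ.filter fun (j : Fin (d + 1)) => ∃ i ≤ n, Ω i j ≠ (0 : ℤ)) = S →
      (fun k => Function.extend e (fun a => Ω k (e a)) (0 : Fin (d + 1) → ℤ)) = Ω := by
    intro Ω hwalk hLU
    funext k j
    by_cases hj : ∃ a, e a = j
    · obtain ⟨a, rfl⟩ := hj
      rw [th_extend_apply_image he]
    · rw [th_extend_apply_of_not_exists _ hj]
      have hjS : j ∉ S := fun h => hj (hrange j h)
      rw [← hLU, Finset.mem_filter] at hjS
      symm
      refine th_apply_eq_zero_of_forall_le hwalk (fun i hi => ?_) k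
      by_contra hne
      exact hjS ⟨Finset.mem_univ _, i, hi, hne⟩
  symm
  refine Finset.card_nbij' (fun (ω : ℕ → Site (u + 1)) (k : ℕ) => Function.extend e (ω k) (0 : Fin (d + 1) → ℤ))
    (fun (Ω : ℕ → Site (d + 1)) (k : ℕ) (a : Fin (u + 1)) => Ω k (e a)) ?_ ?_ ?_ ?_
  · intro ω hω
    rw [Finset.mem_coe, Finset.mem_filter] at hω ⊢
    obtain ⟨hωM, hωr, hall⟩ := hω
    refine ⟨(extend_mem_memWalks_iff he ω).2 hωM, (hrep ω).2 hωr, ?_⟩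
    ext j
    simp only [Finset.mem_filter, Finset.mem_univ, true_and]
    constructor
    · rintro ⟨i, hi, hne⟩
      have hjT : ∃ a, e a = j := by
        by_contra hne'
        exact hne (th_extend_apply_of_not_exists _ hne')
      obtain ⟨a, rfl⟩ := hjT
      exact hmemS a
    · intro hj
      obtain ⟨a, rfl⟩ := hrange j hj
      obtain ⟨i, hi, hne⟩ := hall a
      exact ⟨i, hi, by rwa [th_extend_apply_image he]⟩
  · intro Ω hΩ
    rw [Finset.mem_coe, Finset.mem_filter] at hΩ ⊢
    obtain ⟨hΩM, hΩr, hLU⟩ := hΩ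
    have hwalk : Ω ∈ walks (d + 1) n := (mem_memWalks.1 hΩM).1
    have hΩext := hext Ω hwalk hLU
    refine ⟨(extend_mem_memWalks_iff he _).1 (by rw [hΩext]; exact hΩM), (hrep _).1 (by
      simp only [show ∀ k, Function.extend e (fun a => Ω k (e a)) (0 : Fin (d + 1) → ℤ) = Ω k from
        fun k => congrFun hΩext k]; exact hΩr), ?_⟩
    intro a
    have haS : e a ∈ S := hmemS a
    rw [← hLU, Finset.mem_filter] at haS
    exact haS.2
  · intro ω _
    funext k a
    exact th_extend_apply_image he (ω k) a
  · intro Ω hΩ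
    rw [Finset.mem_coe, Finset.mem_filter] at hΩ
    obtain ⟨hΩM, -, hLU⟩ := hΩ
    exact hext Ω (mem_memWalks.1 hΩM).1 hLU

/-- There are no walks of positive length in `ℤ^0`. [cite: MadrasSlade1993, §1.1 (p. 1); lane plumbing] -/
private theorem th_walks_zero_dim (hn : 1 ≤ n) : walks 0 n = ∅ := by
  rw [Finset.eq_empty_iff_forall_notMem]
  intro ω hω
  obtain ⟨j, -⟩ := (zdGraph_adj_iff_sub _ _).1 ((mem_walks.1 hω).2.2 0 (by omega))
  exact Fin.elim0 j

/-- A walk of positive length uses at least one axis (its first step). [cite: MadrasSlade1993, §1.1 (p. 1); lane plumbing] -/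
private theorem th_usedAxes_nonempty {E : ℕ} {Ω : ℕ → Site E} (hΩ : Ω ∈ walks E n) (hn : 1 ≤ n) :
    (Finset.univ.filter fun (j : Fin E) => ∃ i ≤ n, Ω i j ≠ (0 : ℤ)) ≠ ∅ := by
  obtain ⟨h0, -, -⟩ := mem_walks.1 hΩ
  obtain ⟨j, s, hs, hjs⟩ := th_exists_step_single hΩ (show 0 < n by omega)
  rw [← Finset.nonempty_iff_ne_empty]
  refine ⟨j, Finset.mem_filter.2 ⟨Finset.mem_univ _, 1, hn, ?_⟩⟩
  have h := congrFun hjs j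
  rw [Pi.sub_apply, Pi.single_eq_same, zero_add, h0, Pi.zero_apply, sub_zero] at h
  rw [h]
  rcases hs with rfl | rfl <;> norm_num

/-- ★★ THE AXIS-CLASS IDENTITY FOR THE NON-SELF-AVOIDING MEMORY-`τ` WALKS: for `n ≥ 1` and EVERY `d`, the number of `n`-step memory-`τ`
walks of `ℤ^d` with a repeated site is `Σ_{u < n + 1 − ⌊(τ+2)/2⌋} C(d,u) · G_{n,τ}(u)`, `G_{n,τ}(u)` = the number of such walks of `ℤ^u` using
every axis (the classes beyond the bound are empty by `card_allAxes_badClass_memory_eq_zero`; `τ = 2`: `card_bad_eq_sum_choose_mul`).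
[cite: MadrasSlade1993, §1.1 eq. (1.1.8) and Notes §1.6; §1.2 (p. 10); lane theorem] -/
theorem card_bad_memory_eq_sum_choose_mul (τ d : ℕ) (hn : 1 ≤ n) :
    ((memWalks d τ n).filter fun (Ω : ℕ → Site d) => ∃ i ≤ n, ∃ j ≤ n, i < j ∧ Ω i = Ω j).card =
      ∑ u ∈ Finset.range (n + 1 - (τ + 2) / 2), d.choose u *
        ((memWalks u τ n).filter fun (ω : ℕ → Site u) => (∃ i ≤ n, ∃ j ≤ n, i < j ∧ ω i = ω j) ∧
          ∀ a : Fin u, ∃ i ≤ n, ω i a ≠ (0 : ℤ)).card := by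
  classical
  set G : ℕ → ℕ := fun u => ((memWalks u τ n).filter fun (ω : ℕ → Site u) => (∃ i ≤ n, ∃ j ≤ n, i < j ∧ ω i = ω j) ∧
    ∀ a : Fin u, ∃ i ≤ n, ω i a ≠ (0 : ℤ)).card with hG
  have hG0 : G 0 = 0 := by
    rw [hG]
    simp only
    rw [Finset.card_eq_zero, Finset.filter_eq_empty_iff]
    intro ω hω
    have := (mem_memWalks.1 hω).1
    rw [th_walks_zero_dim hn] at this
    exact absurd this (Finset.notMem_empty ω)
  have hGvan : ∀ u, n + 1 - (τ + 2) / 2 ≤ u → G u = 0 := fun u hu => by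
    rw [hG]
    exact card_allAxes_badClass_memory_eq_zero (by omega)
  have key : ∀ K L : ℕ, (∀ u, K ≤ u → d.choose u * G u = 0) → K ≤ L →
      ∑ u ∈ Finset.range K, d.choose u * G u = ∑ u ∈ Finset.range L, d.choose u * G u := by
    intro K L hKz hKL
    exact Finset.sum_subset (Finset.range_mono hKL) fun u _ hu => hKz u (by simpa [Finset.mem_range] using hu)
  change _ = ∑ u ∈ Finset.range (n + 1 - (τ + 2) / 2), d.choose u * G u
  rw [key (n + 1 - (τ + 2) / 2) (d + n + 1) (fun u hu => by rw [hGvan u hu, mul_zero]) (by omega),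
    ← key (d + 1) (d + n + 1) (fun u hu => by rw [Nat.choose_eq_zero_of_lt (by omega), zero_mul]) (by omega)]
  rcases d with _ | d
  · rw [Finset.sum_range_one, Nat.choose_zero_right, one_mul, hG0, Finset.card_eq_zero, Finset.filter_eq_empty_iff]
    intro ω hω
    have := (mem_memWalks.1 hω).1
    rw [th_walks_zero_dim hn] at this
    exact absurd this (Finset.notMem_empty ω)
  · set W := (memWalks (d + 1) τ n).filter (fun (Ω : ℕ → Site (d + 1)) => ∃ i ≤ n, ∃ j ≤ n, i < j ∧ Ω i = Ω j) with hW
    set P := (Finset.univ : Finset (Fin (d + 1))).powerset with hP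
    have hmaps : ∀ Ω ∈ W, (Finset.univ.filter fun (j : Fin (d + 1)) => ∃ i ≤ n, Ω i j ≠ (0 : ℤ)) ∈ P := by
      intro Ω _
      rw [hP, Finset.mem_powerset]
      exact Finset.filter_subset _ _
    rw [Finset.card_eq_sum_card_fiberwise hmaps]
    have hfib : ∀ S ∈ P, (W.filter fun Ω => (Finset.univ.filter fun (j : Fin (d + 1)) => ∃ i ≤ n, Ω i j ≠ (0 : ℤ)) = S).card =
        G S.card := by
      intro S _
      rw [hW, Finset.filter_filter]
      rcases Nat.eq_zero_or_pos S.card with h0 | hpos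
      · rw [h0, hG0, Finset.card_eq_zero, Finset.filter_eq_empty_iff]
        rintro Ω hΩ ⟨-, hS⟩
        rw [Finset.card_eq_zero] at h0
        rw [h0] at hS
        exact th_usedAxes_nonempty (mem_memWalks.1 hΩ).1 hn hS
      · obtain ⟨u, hu⟩ : ∃ u, S.card = u + 1 := ⟨S.card - 1, by omega⟩
        rw [hu, hG]
        exact card_badClass_memory_eq τ S hu
    rw [Finset.sum_congr rfl hfib]
    have hsum := Finset.sum_powerset_apply_card (fun u : ℕ => G u) (x := (Finset.univ : Finset (Fin (d + 1))))
    rw [Finset.card_univ, Fintype.card_fin] at hsum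
    rw [hP, hsum]
    simp only [smul_eq_mul]

/-- A memory-`τ` walk is self-avoiding iff it has no repeated site. [cite: MadrasSlade1993, §1.2 (p. 10); lane plumbing] -/
private theorem th_mem_saws_iff_not_repeat {ω : ℕ → Site d} (hω : ω ∈ memWalks d τ n) :
    ω ∈ saws d n ↔ ¬ ∃ i ≤ n, ∃ j ≤ n, i < j ∧ ω i = ω j := by
  obtain ⟨hw, -⟩ := mem_memWalks.1 hω
  obtain ⟨h0, hend, hadj⟩ := mem_walks.1 hw
  constructor
  · rintro hs ⟨i, hi, j, hj, hij, heq⟩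
    have := (mem_saws.1 hs).2.2.2 (show i ∈ {k | k ≤ n} by simp only [Set.mem_setOf_eq]; omega)
      (show j ∈ {k | k ≤ n} from hj) heq
    omega
  · intro h
    refine mem_saws.2 ⟨h0, hend, hadj, fun i hi j hj hij => ?_⟩
    simp only [Set.mem_setOf_eq] at hi hj
    by_contra hne
    rcases lt_or_gt_of_ne hne with hlt | hlt
    · exact h ⟨i, hi, j, hj, hlt, hij⟩
    · exact h ⟨j, hj, i, hi, hlt, hij.symm⟩

/-- ★★ For every `τ`, `n ≥ 1` and EVERY `d`: `c_{n,τ}(ℤ^d) = c_n(ℤ^d) + Σ_{u < n + 1 − ⌊(τ+2)/2⌋} C(d,u) · G_{n,τ}(u)` — the memory-`τ`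
counts agree with `c_n` to `⌈(τ+1)/2⌉` orders in `d`. [cite: MadrasSlade1993, §1.2 (p. 10: "c_{N,τ} ≥ c_N", Lemma 1.2.3); lane theorem] -/
theorem memCount_eq_count_add_sum_choose (τ d : ℕ) (hn : 1 ≤ n) :
    memCount d τ n = count d n + ∑ u ∈ Finset.range (n + 1 - (τ + 2) / 2), d.choose u *
      ((memWalks u τ n).filter fun (ω : ℕ → Site u) => (∃ i ≤ n, ∃ j ≤ n, i < j ∧ ω i = ω j) ∧
        ∀ a : Fin u, ∃ i ≤ n, ω i a ≠ (0 : ℤ)).card := by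
  classical
  have hsplit := Finset.card_filter_add_card_filter_not
    (s := memWalks d τ n) (fun (Ω : ℕ → Site d) => ∃ i ≤ n, ∃ j ≤ n, i < j ∧ Ω i = Ω j)
  have hsaws : (memWalks d τ n).filter (fun (Ω : ℕ → Site d) => ¬ ∃ i ≤ n, ∃ j ≤ n, i < j ∧ Ω i = Ω j) = saws d n := by
    ext ω
    rw [Finset.mem_filter]
    constructor
    · rintro ⟨hω, h⟩
      exact (th_mem_saws_iff_not_repeat hω).2 h
    · intro hω
      have hm : ω ∈ memWalks d τ n := saws_subset_memWalks d τ n hω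
      exact ⟨hm, (th_mem_saws_iff_not_repeat hm).1 hω⟩
  rw [hsaws, card_saws, card_bad_memory_eq_sum_choose_mul τ d hn] at hsplit
  rw [memCount, ← hsplit, add_comm]

end ClassesMemory


/-! ### The top THREE coefficients of `c_{n,4}(ℤ^d)` from the Fisher–Sykes recurrence -/

section MemoryFour

variable {n : ℕ}

/-- `c_{n,4}(ℤ^0) = 0` for `n ≥ 1`. [cite: MadrasSlade1993, §1.2 (p. 10); lane plumbing] -/
private theorem th_memCount_zero_dim (τ : ℕ) (hn : 1 ≤ n) : memCount 0 τ n = 0 := by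
  rw [memCount, Finset.card_eq_zero, Finset.eq_empty_iff_forall_notMem]
  intro ω hω
  have := (mem_memWalks.1 hω).1
  rw [th_walks_zero_dim hn] at this
  exact Finset.notMem_empty ω this

/-- A `5`-step walk with memory `4` is self-avoiding (a repeat at distance `5` is excluded by parity): `c_{5,4} = c₅`.
[cite: MadrasSlade1993, §1.2 (p. 10); lane lemma] -/
theorem memCount_four_five (d : ℕ) : memCount d 4 5 = count d 5 := by
  have h := memCount_eq_count_add_sum_choose 4 d (n := 5) (by norm_num)
  rw [show 5 + 1 - (4 + 2) / 2 = 3 by norm_num] at h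
  rw [h]
  refine add_eq_left.2 (Finset.sum_eq_zero fun u _ => mul_eq_zero_of_right _ ?_)
  rw [Finset.card_eq_zero, Finset.filter_eq_empty_iff]
  rintro ω hω ⟨⟨i, hi, j, hj, hij, heq⟩, -⟩
  obtain ⟨hw, hmem⟩ := mem_memWalks.1 hω
  by_cases hfar : j ≤ i + 4
  · exact hmem i j hj hij hfar heq
  · have hi0 : i = 0 := by omega
    have hj5 : j = 5 := by omega
    subst hi0; subst hj5
    exact MemFour.walk_ne_of_odd hw (by norm_num) le_rfl (by norm_num) heq

/-- `c₃, c₄, c₅` of `ℤ^d` as rational polynomials in `d` (from the tree's closed forms). [cite: MadrasSlade1993, §1.1 p. 3; Appendix C, Table C.1] -/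
private theorem th_count_small_cast (d : ℕ) :
    (count d 3 : ℚ) = 8 * (d : ℚ) ^ 3 - 8 * (d : ℚ) ^ 2 + 2 * d ∧
    (count d 4 : ℚ) = 16 * (d : ℚ) ^ 4 - 24 * (d : ℚ) ^ 3 + 8 * (d : ℚ) ^ 2 + 2 * d ∧
    (count d 5 : ℚ) = 32 * (d : ℚ) ^ 5 - 64 * (d : ℚ) ^ 4 + 32 * (d : ℚ) ^ 3 + 12 * (d : ℚ) ^ 2 - 10 * d := by
  have h3 := count_three_eq d
  have h4 := count_four_add d
  have h5 := count_five_add d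
  rcases Nat.eq_zero_or_pos d with rfl | hd
  · simp at h3 h4 h5
    refine ⟨by simp [h3], by simp [h4], by simp [h5]⟩
  · have c1 : ((2 * d - 1 : ℕ) : ℚ) = 2 * d - 1 := by rw [Nat.cast_sub (by omega)]; push_cast; ring
    have c2 : ((2 * d - 2 : ℕ) : ℚ) = 2 * d - 2 := by rw [Nat.cast_sub (by omega)]; push_cast; ring
    have c3 : ((4 * d - 3 : ℕ) : ℚ) = 4 * d - 3 := by rw [Nat.cast_sub (by omega)]; push_cast; ring
    have h3' : (count d 3 : ℚ) = 2 * d * (2 * d - 1) ^ 2 := by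
      have := congrArg (fun x : ℕ => (x : ℚ)) h3; push_cast at this; rw [c1] at this; exact this
    have h4' : (count d 4 : ℚ) + 2 * d * (2 * d - 2) = 2 * d * (2 * d - 1) ^ 3 := by
      have := congrArg (fun x : ℕ => (x : ℚ)) h4; push_cast at this; rw [c1, c2] at this; exact this
    have h5' : (count d 5 : ℚ) + 2 * d * (2 * d - 2) * (4 * d - 3) = 2 * d * (2 * d - 1) ^ 4 := by
      have := congrArg (fun x : ℕ => (x : ℚ)) h5; push_cast at this; rw [c1, c2, c3] at this; exact this
    refine ⟨by rw [h3']; ring, by linear_combination h4', by linear_combination h5'⟩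

/-- ★★ THE TOP THREE COEFFICIENTS OF `c_{n,4}(ℤ^d)`: for every `n ≥ 3` there is `P ∈ ℚ[X]` of degree `≤ n` with
`[X^n]P = 2^n`, `[X^{n−1}]P = −(n−1)2^{n−1}`, `[X^{n−2}]P = 2^{n−3}(n² − 5n + 8)` and `c_{n,4}(ℤ^d) = P(d)` for EVERY `d`
(coefficients written as `2^n/2`, `2^n/8` multiples). Induction on the Fisher–Sykes recurrence `c_{n+3,4} = 2(d−1)(c_{n+2,4} + c_{n+1,4}) + c_{n,4}`
(tree `MemFour.MadrasSlade1993_memCount_four_rec'`) from `c_{3,4} = c₃`, `c_{4,4} = c₄`, `c_{5,4} = c₅`.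
[cite: MadrasSlade1993, §1.2 eq. (1.2.14) (p. 11: Fisher–Sykes); §1.1 p. 3; lane theorem] -/
theorem exists_polynomial_memCount_four_topThree (hn : 3 ≤ n) :
    ∃ P : Polynomial ℚ, P.natDegree ≤ n ∧ P.coeff n = (2 : ℚ) ^ n ∧ P.coeff (n - 1) = -((n : ℚ) - 1) * 2 ^ n / 2 ∧
      P.coeff (n - 2) = 2 ^ n * ((n : ℚ) ^ 2 - 5 * n + 8) / 8 ∧ ∀ d : ℕ, (memCount d 4 n : ℚ) = P.eval (d : ℚ) := by
  induction n using Nat.strong_induction_on with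
  | _ n ih =>
  rcases Nat.lt_or_ge n 6 with hlt | hge
  · -- base cases n = 3, 4, 5
    have hsmall : n = 3 ∨ n = 4 ∨ n = 5 := by omega
    rcases hsmall with rfl | rfl | rfl
    · refine ⟨Polynomial.C 8 * Polynomial.X ^ 3 - Polynomial.C 8 * Polynomial.X ^ 2 + Polynomial.C 2 * Polynomial.X ^ 1,
        by compute_degree, ?_, ?_, ?_, fun d => ?_⟩
      · norm_num [Polynomial.coeff_X_pow]
      · norm_num [Polynomial.coeff_X_pow]
      · norm_num [Polynomial.coeff_X_pow]
      · rw [memCount_eq_count (by norm_num : 3 ≤ 4), (th_count_small_cast d).1]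
        simp [Polynomial.eval_pow]
    · refine ⟨Polynomial.C 16 * Polynomial.X ^ 4 - Polynomial.C 24 * Polynomial.X ^ 3 + Polynomial.C 8 * Polynomial.X ^ 2 +
          Polynomial.C 2 * Polynomial.X ^ 1, by compute_degree, ?_, ?_, ?_, fun d => ?_⟩
      · norm_num [Polynomial.coeff_X_pow]
      · norm_num [Polynomial.coeff_X_pow]
      · norm_num [Polynomial.coeff_X_pow]
      · rw [memCount_eq_count (by norm_num : 4 ≤ 4), (th_count_small_cast d).2.1]
        simp [Polynomial.eval_pow]
    · refine ⟨Polynomial.C 32 * Polynomial.X ^ 5 - Polynomial.C 64 * Polynomial.X ^ 4 + Polynomial.C 32 * Polynomial.X ^ 3 +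
          Polynomial.C 12 * Polynomial.X ^ 2 - Polynomial.C 10 * Polynomial.X ^ 1, by compute_degree, ?_, ?_, ?_, fun d => ?_⟩
      · norm_num [Polynomial.coeff_X_pow]
      · norm_num [Polynomial.coeff_X_pow]
      · norm_num [Polynomial.coeff_X_pow]
      · rw [memCount_four_five, (th_count_small_cast d).2.2]
        simp [Polynomial.eval_pow]
  · -- step: n = m + 3 with m ≥ 3
    obtain ⟨m, rfl⟩ : ∃ m, n = m + 3 := ⟨n - 3, by omega⟩
    obtain ⟨P0, hP0d, hP0a, -, -, hP0e⟩ := ih m (by omega) (by omega)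
    obtain ⟨P1, hP1d, hP1a, hP1b, -, hP1e⟩ := ih (m + 1) (by omega) (by omega)
    obtain ⟨P2, hP2d, hP2a, hP2b, hP2c, hP2e⟩ := ih (m + 2) (by omega) (by omega)
    rw [show m + 1 - 1 = m from rfl] at hP1b
    rw [show m + 2 - 1 = m + 1 from rfl] at hP2b
    rw [show m + 2 - 2 = m from rfl] at hP2c
    rw [show m + 3 - 1 = m + 2 from rfl, show m + 3 - 2 = m + 1 from rfl]
    -- vanishing coefficients above the degree bounds
    have hP0z1 : P0.coeff (m + 1) = 0 := Polynomial.coeff_eq_zero_of_natDegree_lt (by omega)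
    have hP0z2 : P0.coeff (m + 2) = 0 := Polynomial.coeff_eq_zero_of_natDegree_lt (by omega)
    have hP0z3 : P0.coeff (m + 3) = 0 := Polynomial.coeff_eq_zero_of_natDegree_lt (by omega)
    have hP1z2 : P1.coeff (m + 2) = 0 := Polynomial.coeff_eq_zero_of_natDegree_lt (by omega)
    have hP1z3 : P1.coeff (m + 3) = 0 := Polynomial.coeff_eq_zero_of_natDegree_lt (by omega)
    have hP2z3 : P2.coeff (m + 3) = 0 := Polynomial.coeff_eq_zero_of_natDegree_lt (by omega)
    -- the recurrence polynomial `2 (X − 1) (P2 + P1) + P0 = 2·X·(P2+P1) − 2·(P2+P1) + P0`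
    refine ⟨Polynomial.C 2 * (Polynomial.X * (P2 + P1)) - Polynomial.C 2 * (P2 + P1) + P0, ?_, ?_, ?_, ?_, fun d => ?_⟩
    · have h12 : (P2 + P1).natDegree ≤ m + 2 := (Polynomial.natDegree_add_le _ _).trans (max_le hP2d (by omega))
      refine (Polynomial.natDegree_add_le _ _).trans (max_le ?_ (by omega))
      refine (Polynomial.natDegree_sub_le _ _).trans (max_le ?_ ((Polynomial.natDegree_C_mul_le _ _).trans (by omega)))
      refine (Polynomial.natDegree_C_mul_le _ _).trans (Polynomial.natDegree_mul_le.trans ?_)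
      rw [Polynomial.natDegree_X]; omega
    · simp only [Polynomial.coeff_add, Polynomial.coeff_sub, Polynomial.coeff_C_mul, Polynomial.coeff_X_mul,
        hP2a, hP1z2, hP2z3, hP1z3, hP0z3]
      ring
    · simp only [Polynomial.coeff_add, Polynomial.coeff_sub, Polynomial.coeff_C_mul, Polynomial.coeff_X_mul,
        hP2b, hP1a, hP2a, hP1z2, hP0z2]
      push_cast; ring
    · simp only [Polynomial.coeff_add, Polynomial.coeff_sub, Polynomial.coeff_C_mul, Polynomial.coeff_X_mul,
        hP2c, hP1b, hP2b, hP1a, hP0z1]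
      push_cast; ring
    · rcases Nat.eq_zero_or_pos d with rfl | hd
      · -- dimension 0: everything vanishes
        have e0 := hP0e 0; have e1 := hP1e 0; have e2 := hP2e 0
        rw [th_memCount_zero_dim 4 (by omega)] at e0 e1 e2 ⊢
        simp only [Polynomial.eval_add, Polynomial.eval_sub, Polynomial.eval_mul, Polynomial.eval_C, Polynomial.eval_X]
        push_cast at e0 e1 e2 ⊢
        rw [← e0, ← e1, ← e2]; ring
      · haveI : NeZero d := ⟨by omega⟩
        have hrec := MemFour.MadrasSlade1993_memCount_four_rec' d (n := m) (by omega)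
        have hrecQ : (memCount d 4 (m + 3) : ℚ) = (2 * (d : ℚ) - 2) * (memCount d 4 (m + 2) + memCount d 4 (m + 1)) + memCount d 4 m := by
          have := congrArg (fun x : ℤ => (x : ℚ)) hrec; push_cast at this; exact this
        rw [hrecQ, hP0e d, hP1e d, hP2e d]
        simp only [Polynomial.eval_add, Polynomial.eval_sub, Polynomial.eval_mul, Polynomial.eval_C, Polynomial.eval_X]
        ring

end MemoryFour

/-! ### Assembly: the top THREE coefficients of `c_n(ℤ^d)` -/

section Assembly

variable {n : ℕ}

/-- ★★★ THE TOP THREE COEFFICIENTS OF `c_n(ℤ^d)` IN THE DIMENSION: for every `n ≥ 3` there is `P ∈ ℚ[X]` of degree `≤ n` with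
`[X^n]P = 2^n`, `[X^{n−1}]P = −(n−1)·2^{n−1}`, `[X^{n−2}]P = 2^{n−3}(n² − 5n + 8)` and `c_n(ℤ^d) = P(d)` for EVERY `d ∈ ℕ`
(`c_n` and the memory-4 count `c_{n,4}` agree to three orders in `d` — a repeat in a memory-4 walk costs three axes —, and the
top three coefficients of `c_{n,4}` follow from the Fisher–Sykes recurrence). E.g. `[d⁴] c₆ = 112`, `[d⁵] c₇ = 2⁴·22 = 352`.
[cite: MadrasSlade1993, §1.1 p. 3 and eq. (1.1.8) p. 5 (the 1/d expansion); §1.2 eq. (1.2.14) p. 11; lane theorem] -/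
theorem exists_polynomial_count_topThree (hn : 3 ≤ n) :
    ∃ P : Polynomial ℚ, P.natDegree ≤ n ∧ P.coeff n = (2 : ℚ) ^ n ∧ P.coeff (n - 1) = -((n : ℚ) - 1) * 2 ^ (n - 1) ∧
      P.coeff (n - 2) = 2 ^ (n - 3) * ((n : ℚ) ^ 2 - 5 * n + 8) ∧ ∀ d : ℕ, (count d n : ℚ) = P.eval (d : ℚ) := by
  classical
  obtain ⟨Q, hQd, hQa, hQb, hQc, hQe⟩ := exists_polynomial_memCount_four_topThree hn
  set G : ℕ → ℕ := fun u => ((memWalks u 4 n).filter fun (ω : ℕ → Site u) =>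
    (∃ i ≤ n, ∃ j ≤ n, i < j ∧ ω i = ω j) ∧ ∀ a : Fin u, ∃ i ≤ n, ω i a ≠ (0 : ℤ)).card with hG
  set B : Polynomial ℚ := ∑ u ∈ Finset.range (n - 2), Polynomial.C ((G u : ℚ) / (u.factorial : ℚ)) * descPochhammer ℚ u
    with hBdef
  have hBcoeff : ∀ k, n - 2 ≤ k → B.coeff k = 0 := by
    intro k hk
    rw [hBdef, Polynomial.finsetSum_coeff]
    refine Finset.sum_eq_zero fun u hu => ?_
    rw [Polynomial.coeff_C_mul, Polynomial.coeff_eq_zero_of_natDegree_lt, mul_zero]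
    rw [descPochhammer_natDegree]
    have := Finset.mem_range.1 hu
    omega
  have hBdeg : B.natDegree ≤ n := by
    refine Polynomial.natDegree_sum_le_of_forall_le _ _ fun u hu => ?_
    calc (Polynomial.C ((G u : ℚ) / (u.factorial : ℚ)) * descPochhammer ℚ u).natDegree
        ≤ (descPochhammer ℚ u).natDegree := Polynomial.natDegree_C_mul_le _ _
      _ = u := descPochhammer_natDegree ℚ u
      _ ≤ n := by have := Finset.mem_range.1 hu; omega
  refine ⟨Q - B, (Polynomial.natDegree_sub_le _ _).trans (max_le hQd hBdeg), ?_, ?_, ?_, fun d => ?_⟩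
  · rw [Polynomial.coeff_sub, hQa, hBcoeff n (by omega), sub_zero]
  · rw [Polynomial.coeff_sub, hQb, hBcoeff (n - 1) (by omega), sub_zero]
    obtain ⟨m, rfl⟩ : ∃ m, n = m + 1 := ⟨n - 1, by omega⟩
    rw [Nat.add_sub_cancel, pow_succ]; ring
  · rw [Polynomial.coeff_sub, hQc, hBcoeff (n - 2) le_rfl, sub_zero]
    obtain ⟨m, rfl⟩ : ∃ m, n = m + 3 := ⟨n - 3, by omega⟩
    rw [show m + 3 - 3 = m from rfl, pow_add]; ring
  · have h := memCount_eq_count_add_sum_choose 4 d (n := n) (by omega)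
    rw [show n + 1 - (4 + 2) / 2 = n - 2 by omega] at h
    have hcount : (count d n : ℚ) = (memCount d 4 n : ℚ) - ∑ u ∈ Finset.range (n - 2), (d.choose u : ℚ) * (G u : ℚ) := by
      rw [h]; push_cast; ring
    rw [hcount, hQe d, Polynomial.eval_sub, hBdef, Polynomial.eval_finsetSum]
    congr 1
    refine Finset.sum_congr rfl fun u _ => ?_
    have hf : (u.factorial : ℚ) ≠ 0 := by exact_mod_cast u.factorial_ne_zero
    rw [Polynomial.eval_mul, Polynomial.eval_C, descPochhammer_eval_eq_descFactorial ℚ d u,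
      Nat.descFactorial_eq_factorial_mul_choose, Nat.cast_mul, div_mul_eq_mul_div, mul_div_assoc,
      mul_div_cancel_left₀ _ hf, mul_comm]

end Assembly
end Literature.Probability.RandomPlanarGeometry.SAW.Zd
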